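import Summits.AtomisticToContinuum.HydrodynamicLimit.Theorems.LambertianContactSwapLambertianEulerEstimateOfHearts
import Summits.AtomisticToContinuum.HydrodynamicLimit.Theses.LambertianContactSwap
import Summits.AtomisticToContinuum.HydrodynamicLimit.Theses.LindebergRandomFuture
import Summits.AtomisticToContinuum.HydrodynamicLimit.Theorems.LambertianContactSwapLambertianEulerEntropyToHydro
import Summits.AtomisticToContinuum.HydrodynamicLimit.Theorems.LambertianContactSwapLambertianEulerDock
import Summits.AtomisticToContinuum.HydrodynamicLimit.Theorems.LambertianContactSwapLambertianEulerKlLedger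
import Summits.AtomisticToContinuum.HydrodynamicLimit.Theorems.TwoClocksClampedEntropyClockTimeZeroReference
import Summits.AtomisticToContinuum.HydrodynamicLimit.Theorems.TwoClocksClampedEntropyClockDiscreteEntropyGronwall
import Summits.AtomisticToContinuum.HydrodynamicLimit.Theorems.TwoClocksClampedEntropyClockKlDivLawAtLocalGibbsNeTop
import HarnessLib

/-!
# `LambertianEuler` from its two research hearts and dilute self-consistency (line `Sketch`, crux stmt-11854)

Support file (`--supports stmt-AtomisticToContinuum-11854`) recording IN THE TREE the kernel-checked composition of the registered
skeleton `Cruxes/LambertianEuler/Lines/Sketch.lean` (v33): `lambertianEuler_of_hearts :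
KineticOneBlockInMeanLambda → CollisionalOneBlockInMeanLambda → ImplosionDichotomy.DiluteSelfConsistency → LambertianContactSwap.LambertianEuler`
(and the sister copy `LindebergRandomFuture.LambertianEuler`), through ESTIMATE ⇒ BOUND (FORMULA p128635 + activity smoothness) ⇒
WINDOW STEP (one-window ledger p122335) ⇒ GRONWALL along the explicit reference (time-zero reference p101191, `H_N(0) = 0` by
`map_lambertFlow_zero_localGibbsLaw`, ledger finiteness p120487, discrete window Gronwall p100251) ⇒ Rf-dock (p120849) ⇒
entropy→hydro glue (p106285).  Once P3Λ, P4Λ (to be promoted to items) and stmt-3091 are theorems, the crux closes by a five-line file.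
Precedent: `HydroLimitInBandOfHeart.hydroLimitInBand_of_heart` (p122696) for the sibling deterministic crux stmt-9133.
Lead prover-line-stmt-AtomisticToContinuum-11854-c6-0 (cycle 1), 2026-08-17.  [cite: Yau1991, §2] [cite: OllaVaradhanYau1993, §3–§4]
-/

noncomputable section

namespace Summit.AtomisticToContinuum.HydrodynamicLimit.Theorems.LambertianContactSwapLambertianEulerOfHearts

open scoped BigOperators Topology ENNReal InnerProductSpace
open MeasureTheory ProbabilityTheory Filter Set InformationTheory
open Literature.MathematicalPhysics.KineticTheory
open Literature.Analysis.FluidPDE Literature.Analysis.FluidPDE.Alexander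
open Summit.AtomisticToContinuum.HydrodynamicLimit.Theorems.ClampedCurrentsDockPathwise (gSum DgSum)
open Summit.AtomisticToContinuum.HydrodynamicLimit.Theorems.LambertianContactSwapLambertianEulerHearts
open Summit.AtomisticToContinuum.HydrodynamicLimit.Theorems.LambertianContactSwapLambertianEulerEstimateOfHearts

/-! ## §1 ESTIMATE ⇒ BOUND ⇒ WINDOW STEP ⇒ GRONWALL -/

/-- **ESTIMATE ⇒ BOUND** through the FORMULA (p128635) and the joint smoothness of the explicit activity (`isSmoothSpaceTimeOn_activityRf`; `DiluteSelfConsistency` keeps `σ³ρ` in its band). [cite: Yau1991, §2] -/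
theorem windowProductionBoundLambda_of_estimate (hEst : WindowProductionEstimateLambda)
    (hS : Summit.AtomisticToContinuum.HydrodynamicLimit.Theses.ImplosionDichotomy.DiluteSelfConsistency) :
    WindowProductionBoundLambda := by
  intro r Rf hr hsol hbd hcont huniq a₀ θ₀ u₀ ha hθ hu ha0 hθ0
  obtain ⟨σE, hσE, HE⟩ := hEst r Rf hr hsol hbd hcont huniq a₀ θ₀ u₀ ha hθ hu ha0 hθ0
  obtain ⟨η, hη, hηr, Hsm⟩ := isSmoothSpaceTimeOn_activityRf hr huniq
  obtain ⟨σS, hσS, HS⟩ := hS η hη a₀ θ₀ u₀ ha hθ hu ha0 hθ0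
  refine ⟨min σE (min σS 2⁻¹), lt_min hσE (lt_min hσS (by norm_num)), ?_⟩
  intro σ hσ hσlt T ρ θ u hEul Φ htie t ht
  have hσE' : σ < σE := hσlt.trans_le (min_le_left _ _)
  have hσS' : σ < σS := hσlt.trans_le ((min_le_right _ _).trans (min_le_left _ _))
  have hσi : σ < 2⁻¹ := hσlt.trans_le ((min_le_right _ _).trans (min_le_right _ _))
  obtain ⟨A, hA, HA⟩ := HE σ hσ hσE' T ρ θ u hEul Φ htie t ht
  refine ⟨A, hA, fun ε hε => ?_⟩
  obtain ⟨w, hw, N₀, HN⟩ := HA ε hε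
  refine ⟨w, hw, N₀, fun N hN => ?_⟩
  obtain ⟨H1, H2⟩ := HN N hN
  have hσ3 : 0 < σ ^ 3 := by positivity
  have hrange : ∀ t' ∈ Set.Ico 0 T, ∀ x, 0 < σ ^ 3 * ρ t' x ∧ σ ^ 3 * ρ t' x < η := fun t' ht' x =>
    ⟨mul_pos hσ3 (hEul.density_pos t' ht' x), by
      have h := HS σ hσ hσS' T ρ θ u hEul Φ htie t' ht' x; nlinarith [h]⟩
  have hsmooth : Literature.Analysis.FunctionSpaces.Torus.IsSmoothSpaceTimeOn (Set.Ico 0 T)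
      (fun r' x => ρ r' x * Rf (σ ^ 3 * ρ r' x)) := Hsm hEul.smooth_density hrange
  have hapos : ∀ t' ∈ Set.Ico 0 T, ∀ x, 0 < ρ t' x * Rf (σ ^ 3 * ρ t' x) := fun t' ht' x =>
    mul_pos (hEul.density_pos t' ht' x)
      (hsol _ ⟨by linarith [(hrange t' ht' x).1], (hrange t' ht' x).2.trans_le hηr⟩).1
  constructor
  · intro s hs hsw
    have hF := (Summit.AtomisticToContinuum.HydrodynamicLimit.Theorems.LambertianContactSwapLambertianEulerExpectedWindowProduction.stub_expectedWindowProductionLambda hσ hσi ha hθ hu ha0 hθ0 T N (Φ N)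
      (fun r' x => ρ r' x * Rf (σ ^ 3 * ρ r' x)) θ u hsmooth hEul.smooth_temperature hEul.smooth_velocity
      hapos hEul.temperature_pos s (w N) hs (hw N).le (by linarith [ht.2])).2.2
    beta_reduce at hF
    exact (le_of_eq hF).trans (H1 s hs hsw)
  · intro s hs hst htsw
    have hF := (Summit.AtomisticToContinuum.HydrodynamicLimit.Theorems.LambertianContactSwapLambertianEulerExpectedWindowProduction.stub_expectedWindowProductionLambda hσ hσi ha hθ hu ha0 hθ0 T N (Φ N)
      (fun r' x => ρ r' x * Rf (σ ^ 3 * ρ r' x)) θ u hsmooth hEul.smooth_temperature hEul.smooth_velocity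
      hapos hEul.temperature_pos s (t - s) hs (by linarith) (by linarith [ht.2])).2.2
    beta_reduce at hF
    simp only [show s + (t - s) = t by ring] at hF
    exact (le_of_eq hF).trans (H2 s hs hst htsw)


/-- **BOUND ⇒ WINDOW STEP** through the one-window ledger (p122335): `(1 + A w) H = H + A w H`. [cite: Yau1991, §2] -/
theorem windowStepLambda_of_bound (hB : WindowProductionBoundLambda)
    (hS : Summit.AtomisticToContinuum.HydrodynamicLimit.Theses.ImplosionDichotomy.DiluteSelfConsistency) :
    WindowStepLambda := by
  intro r Rf hr hsol hbd hcont huniq a₀ θ₀ u₀ ha hθ hu ha0 hθ0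
  obtain ⟨σb, hσb, Hb⟩ := hB r Rf hr hsol hbd hcont huniq a₀ θ₀ u₀ ha hθ hu ha0 hθ0
  -- dilute self-consistency at `η = r/2` keeps `σ³ρ_s` inside the domain of `Rf`
  obtain ⟨σd, hσd, Hd⟩ := hS (r / 2) (by positivity) a₀ θ₀ u₀ ha hθ hu ha0 hθ0
  refine ⟨min σb (min σd (1 / 2)), lt_min hσb (lt_min hσd (by norm_num)), ?_⟩
  intro σ hσ hσlt T ρ θ u hE Φ htie t ht
  have hσb' : σ < σb := hσlt.trans_le (min_le_left _ _)
  have hσd' : σ < σd := hσlt.trans_le ((min_le_right _ _).trans (min_le_left _ _))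
  have hσ2' : σ < 1 / 2 := hσlt.trans_le ((min_le_right _ _).trans (min_le_right _ _))
  have hσi : σ < 2⁻¹ := by rw [inv_eq_one_div]; exact hσ2'
  -- the reference profiles along `[0, t]`: continuity and positivity
  have href : ∀ s ∈ Set.Icc 0 t, (Continuous fun x => ρ s x * Rf (σ ^ 3 * ρ s x)) ∧
      (∀ x, 0 < ρ s x * Rf (σ ^ 3 * ρ s x)) ∧ Continuous (θ s) ∧ Continuous (u s) ∧ ∀ x, 0 < θ s x := by
    intro s hs
    have hsI : s ∈ Set.Ico 0 T := ⟨hs.1, hs.2.trans_lt ht.2⟩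
    have hρc : Continuous (ρ s) := (hE.smooth_density.isSmooth_slice hsI).continuous
    have huc : Continuous (u s) := (hE.smooth_velocity.isSmooth_slice hsI).continuous
    have hθc : Continuous (θ s) := (hE.smooth_temperature.isSmooth_slice hsI).continuous
    have hρpos : ∀ x, 0 < ρ s x := hE.density_pos s hsI
    have hθpos : ∀ x, 0 < θ s x := hE.temperature_pos s hsI
    have hσ3 : 0 < σ ^ 3 := by positivity
    have hmem : ∀ x, σ ^ 3 * ρ s x ∈ Set.Icc 0 r := fun x => by
      have h := Hd σ hσ hσd' T ρ θ u hE Φ htie s hsI x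
      exact ⟨(mul_pos hσ3 (hρpos x)).le, by nlinarith [h, hρpos x, hr]⟩
    have hbc : Continuous fun x => ρ s x * Rf (σ ^ 3 * ρ s x) :=
      hρc.mul (hcont.comp_continuous (continuous_const.mul hρc) hmem)
    have hbpos : ∀ x, 0 < ρ s x * Rf (σ ^ 3 * ρ s x) := fun x =>
      mul_pos (hρpos x) (one_pos.trans_le (hbd _ (hmem x)).1)
    exact ⟨hbc, hbpos, hθc, huc, hθpos⟩
  obtain ⟨A, hA, H⟩ := Hb σ hσ hσb' T ρ θ u hE Φ htie t ht
  refine ⟨A, hA, fun ε hε => ?_⟩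
  obtain ⟨w, hw, N₀, HN⟩ := H ε hε
  refine ⟨w, hw, N₀, fun N hN => ?_⟩
  obtain ⟨hfull, hpart⟩ := HN N hN
  constructor
  · intro s hs hsw
    have hs' : s ∈ Set.Icc 0 t := ⟨hs, by linarith [hw N]⟩
    have hsw' : s + w N ∈ Set.Icc 0 t := ⟨by linarith [hw N], hsw⟩
    obtain ⟨hb, hbp, hθc, huc, hθp⟩ := href s hs'
    obtain ⟨hb', hbp', hθc', huc', hθp'⟩ := href (s + w N) hsw'
    have hL := (Summit.AtomisticToContinuum.HydrodynamicLimit.Theorems.LambertianContactSwapLambertianEulerWindowLedger.stub_windowLedgerLambda hσ hσi ha hθ hu ha0 hθ0 hb hθc huc hbp hθp hb' hθc' huc' hbp' hθp'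
      N (Φ N) s (w N) hs (hw N).le).2
    have hP := hfull s hs hsw
    unfold Hent at hP ⊢
    have hring : (1 + A * w N) * (klDiv (((localGibbsLaw σ a₀ u₀ θ₀ N (Φ N)).prod (lambertNoise (Fin 3))).map
        (fun p => lambertFlow (Torus.geometry (Fin 3)) (hsDiameter σ N) p.2 p.1 s))
        (localGibbsLaw σ (fun x => ρ s x * Rf (σ ^ 3 * ρ s x)) (u s) (θ s) N (Φ N))).toReal =
      (klDiv (((localGibbsLaw σ a₀ u₀ θ₀ N (Φ N)).prod (lambertNoise (Fin 3))).map
        (fun p => lambertFlow (Torus.geometry (Fin 3)) (hsDiameter σ N) p.2 p.1 s))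
        (localGibbsLaw σ (fun x => ρ s x * Rf (σ ^ 3 * ρ s x)) (u s) (θ s) N (Φ N))).toReal + A * w N * (klDiv (((localGibbsLaw σ a₀ u₀ θ₀ N (Φ N)).prod (lambertNoise (Fin 3))).map
        (fun p => lambertFlow (Torus.geometry (Fin 3)) (hsDiameter σ N) p.2 p.1 s))
        (localGibbsLaw σ (fun x => ρ s x * Rf (σ ^ 3 * ρ s x)) (u s) (θ s) N (Φ N))).toReal := by ring
    rw [hring]
    linarith
  · intro s hs hst htw
    have hs' : s ∈ Set.Icc 0 t := ⟨hs, hst⟩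
    obtain ⟨hb, hbp, hθc, huc, hθp⟩ := href s hs'
    obtain ⟨hb', hbp', hθc', huc', hθp'⟩ := href t ⟨ht.1.le, le_rfl⟩
    have hL := (Summit.AtomisticToContinuum.HydrodynamicLimit.Theorems.LambertianContactSwapLambertianEulerWindowLedger.stub_windowLedgerLambda hσ hσi ha hθ hu ha0 hθ0 hb hθc huc hbp hθp hb' hθc' huc' hbp' hθp'
      N (Φ N) s (t - s) hs (sub_nonneg.2 hst)).2
    rw [show s + (t - s) = t by ring] at hL
    have hP := hpart s hs hst htw
    unfold Hent at hP ⊢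
    linarith


/-- **WINDOW STEP ⇒ GRONWALL** along the explicit reference family: `H_N(0) = 0` (the law of `Λ_0` under `λ_N ⊗ γ^ℕ` is `λ_N`, `map_lambertFlow_zero_localGibbsLaw`, and the time-`0` member of the family IS `λ_N`, `QuenchedCellClock.stub_timeZeroReference` p101191), finiteness of the entropies along the family on `[0, t]` (clause 1 of the ledger p120487; `DiluteSelfConsistency` at `η = r/2` keeps `σ³ρ_s` inside the domain of `Rf`), telescoping over grid windows fed into the abstract window Gronwall `QuenchedCellClock.stub_discreteEntropyGronwall` (p100251), and `ℝ≥0∞` bookkeeping. [cite: Yau1991, §2] -/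
theorem gronwallRfLambda_of_windowStep (hW : WindowStepLambda)
    (hS : Summit.AtomisticToContinuum.HydrodynamicLimit.Theses.ImplosionDichotomy.DiluteSelfConsistency) :
    GronwallRfLambda := by
  intro r Rf hr hsol hbd hcont huniq a₀ θ₀ u₀ ha hθ hu ha0 hθ0
  obtain ⟨σb, hσb, Hb⟩ := hW r Rf hr hsol hbd hcont huniq a₀ θ₀ u₀ ha hθ hu ha0 hθ0
  obtain ⟨σc, hσc, Hc⟩ :=
    Summit.AtomisticToContinuum.HydrodynamicLimit.Theorems.QuenchedCellClock.stub_timeZeroReference hr hsol hbd hcont huniq a₀ θ₀ u₀ ha hθ hu ha0 hθ0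
  -- dilute self-consistency at `η = r/2` keeps `σ³ρ_s` inside the domain of `Rf`
  obtain ⟨σd, hσd, Hd⟩ := hS (r / 2) (by positivity) a₀ θ₀ u₀ ha hθ hu ha0 hθ0
  refine ⟨min σb (min σc (min σd (1 / 2))), lt_min hσb (lt_min hσc (lt_min hσd (by norm_num))), ?_⟩
  intro σ hσ hσlt T ρ θ u hE Φ htie t ht _hac _hap _hale _hQs _hlim
  have hσb' : σ < σb := hσlt.trans_le (min_le_left _ _)
  have hσc' : σ < σc := hσlt.trans_le ((min_le_right _ _).trans (min_le_left _ _))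
  have hσd' : σ < σd :=
    hσlt.trans_le ((min_le_right _ _).trans ((min_le_right _ _).trans (min_le_left _ _)))
  have hσ2' : σ < 1 / 2 :=
    hσlt.trans_le ((min_le_right _ _).trans ((min_le_right _ _).trans (min_le_right _ _)))
  have hσ2 : σ ≤ 1 / 2 := hσ2'.le
  have hσi : σ < 2⁻¹ := by rw [inv_eq_one_div]; exact hσ2'
  have hT0 : 0 < T := ht.1.trans ht.2
  obtain ⟨A, hA, hstep⟩ := Hb σ hσ hσb' T ρ θ u hE Φ htie t ht
  have hlaw := Hc σ hσ hσc' T ρ θ u hE hT0 Φ htie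
  -- finiteness of the relative entropies along the explicit reference family on `[0, t]` (ledger, clause 1)
  have hfin : ∀ (N : ℕ) (s : ℝ), s ∈ Set.Icc 0 t →
      klDiv (((localGibbsLaw σ a₀ u₀ θ₀ N (Φ N)).prod (lambertNoise (Fin 3))).map
          (fun p => lambertFlow (Torus.geometry (Fin 3)) (hsDiameter σ N) p.2 p.1 s))
        (localGibbsLaw σ (fun x => ρ s x * Rf (σ ^ 3 * ρ s x)) (u s) (θ s) N (Φ N)) ≠ ⊤ := by
    intro N s hs
    have hsI : s ∈ Set.Ico 0 T := ⟨hs.1, hs.2.trans_lt ht.2⟩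
    have hρc : Continuous (ρ s) := (hE.smooth_density.isSmooth_slice hsI).continuous
    have huc : Continuous (u s) := (hE.smooth_velocity.isSmooth_slice hsI).continuous
    have hθc : Continuous (θ s) := (hE.smooth_temperature.isSmooth_slice hsI).continuous
    have hρpos : ∀ x, 0 < ρ s x := hE.density_pos s hsI
    have hθpos : ∀ x, 0 < θ s x := hE.temperature_pos s hsI
    have hσ3 : 0 < σ ^ 3 := by positivity
    have hmem : ∀ x, σ ^ 3 * ρ s x ∈ Set.Icc 0 r := fun x => by
      have h := Hd σ hσ hσd' T ρ θ u hE Φ htie s hsI x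
      exact ⟨(mul_pos hσ3 (hρpos x)).le, by nlinarith [h, hρpos x, hr]⟩
    have hbc : Continuous fun x => ρ s x * Rf (σ ^ 3 * ρ s x) :=
      hρc.mul (hcont.comp_continuous (continuous_const.mul hρc) hmem)
    have hbpos : ∀ x, 0 < ρ s x * Rf (σ ^ 3 * ρ s x) := fun x =>
      mul_pos (hρpos x) (one_pos.trans_le (hbd _ (hmem x)).1)
    haveI := isProbabilityMeasure_localGibbsLaw ha hθ hu ha0 hθ0 hσ2 N (Φ N)
    have hPL : localGibbsLaw σ a₀ u₀ θ₀ N (Φ N) ≪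
        liouville (Torus.geometry (Fin 3)) (N + 1) (hsDiameter σ N) := by
      rw [localGibbsLaw, particleLaw_eq]; exact withDensity_absolutelyContinuous _ _
    have hEn := Summit.AtomisticToContinuum.HydrodynamicLimit.Theorems.QuenchedCellClock.integrable_sum_norm_sq_localGibbsLaw
      ha hθ hu (fun x => (ha0 x).le) hθ0 N (Φ N)
    have hK0 : klDiv (localGibbsLaw σ a₀ u₀ θ₀ N (Φ N)) (localGibbsLaw σ a₀ u₀ θ₀ N (Φ N)) ≠ ⊤ := by
      rw [klDiv_self]; exact ENNReal.zero_ne_top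
    exact (Summit.AtomisticToContinuum.HydrodynamicLimit.Theorems.LambertianContactSwapLambertianEulerKlLedger.stub_klLedgerLambda hσ hσi ha hθ hu ha0 hθ0 hbc hθc huc hbpos hθpos N (Φ N)
      (localGibbsLaw σ a₀ u₀ θ₀ N (Φ N)) hPL hEn hK0 s hs.1).1
  -- the real-valued entropies along the explicit reference family
  set H : ℕ → ℝ → ℝ := fun N s =>
    (klDiv (((localGibbsLaw σ a₀ u₀ θ₀ N (Φ N)).prod (lambertNoise (Fin 3))).map
          (fun p => lambertFlow (Torus.geometry (Fin 3)) (hsDiameter σ N) p.2 p.1 s))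
      (localGibbsLaw σ (fun x => ρ s x * Rf (σ ^ 3 * ρ s x)) (u s) (θ s) N (Φ N))).toReal with hH
  have hH0 : ∀ N s, 0 ≤ H N s := fun N s => ENNReal.toReal_nonneg
  have hzero : Tendsto (fun N : ℕ => H N 0 / ((N : ℝ) + 1)) atTop (𝓝 0) := by
    have h0 : ∀ N, H N 0 = 0 := by
      intro N
      haveI := isProbabilityMeasure_localGibbsLaw ha hθ hu ha0 hθ0 hσ2 N (Φ N)
      simp only [hH, hlaw N,
        Summit.AtomisticToContinuum.HydrodynamicLimit.Theorems.LambertianContactSwapLambertianEulerDock.map_lambertFlow_zero_localGibbsLaw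
          hσ hσi ha hθ hu
          ha0 hθ0 N (Φ N), klDiv_self, ENNReal.toReal_zero]
    simp only [h0, zero_div]
    exact tendsto_const_nhds
  have hreal : Tendsto (fun N : ℕ => H N t / ((N : ℝ) + 1)) atTop (𝓝 0) :=
    Summit.AtomisticToContinuum.HydrodynamicLimit.Theorems.QuenchedCellClock.stub_discreteEntropyGronwall H ht.1 hA hH0 hzero hstep
  -- back to `ℝ≥0∞`
  have hcongr : ∀ N : ℕ, klDiv (((localGibbsLaw σ a₀ u₀ θ₀ N (Φ N)).prod (lambertNoise (Fin 3))).map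
          (fun p => lambertFlow (Torus.geometry (Fin 3)) (hsDiameter σ N) p.2 p.1 t))
      (localGibbsLaw σ (fun x => ρ t x * Rf (σ ^ 3 * ρ t x)) (u t) (θ t) N (Φ N)) / ((N : ℝ≥0∞) + 1) =
      ENNReal.ofReal (H N t / ((N : ℝ) + 1)) := by
    intro N
    have hNpos : (0 : ℝ) < (N : ℝ) + 1 := by positivity
    rw [ENNReal.ofReal_div_of_pos hNpos, hH, ENNReal.ofReal_toReal (hfin N t ⟨ht.1.le, le_rfl⟩)]
    congr 1
    rw [ENNReal.ofReal_add (by positivity) zero_le_one, ENNReal.ofReal_natCast, ENNReal.ofReal_one]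
  simp only [hcongr]
  rw [← ENNReal.ofReal_zero]
  exact ENNReal.tendsto_ofReal hreal


/-! ## §2 The reduction of the crux to its hearts -/

/-- **THE REDUCTION OF THE CRUX TO ITS HEARTS.** `LambertianContactSwap.LambertianEuler` follows from the kinetic heart
P3Λ, the collisional heart P4Λ and the shared item `ImplosionDichotomy.DiluteSelfConsistency` (stmt-3091): entropy→hydro glue
(p106285) ∘ Rf-dock (p120849) ∘ GRONWALL ∘ WINDOW STEP ∘ BOUND ∘ ESTIMATE ∘ hearts. [cite: Yau1991, §2] [cite: OllaVaradhanYau1993, §3–§4] -/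
theorem lambertianEuler_of_hearts : Summit.AtomisticToContinuum.HydrodynamicLimit.Theorems.LambertianContactSwapLambertianEulerHearts.KineticOneBlockInMeanLambda → Summit.AtomisticToContinuum.HydrodynamicLimit.Theorems.LambertianContactSwapLambertianEulerHearts.CollisionalOneBlockInMeanLambda → Summit.AtomisticToContinuum.HydrodynamicLimit.Theses.ImplosionDichotomy.DiluteSelfConsistency → Summit.AtomisticToContinuum.HydrodynamicLimit.Theses.LambertianContactSwap.LambertianEuler :=
  fun h3 h4 hD =>
  Summit.AtomisticToContinuum.HydrodynamicLimit.Theorems.LambertianContactSwapLambertianEulerEntropyToHydro.stub_entropyToHydroLambda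
    (Summit.AtomisticToContinuum.HydrodynamicLimit.Theorems.LambertianContactSwapLambertianEulerDockRf.stub_dockLambdaRf
      (fun r Rf hr hsol hbd hcont huniq _ =>
        gronwallRfLambda_of_windowStep
          (windowStepLambda_of_bound
            (windowProductionBoundLambda_of_estimate (windowProductionEstimateLambda_of_hearts h3 h4 hD) hD) hD)
          hD r Rf hr hsol hbd hcont huniq)
      hD)

/-- The same reduction read as the sister route's copy `LindebergRandomFuture.LambertianEuler` (byte-identical body).
[cite: Yau1991, §2] -/
theorem lindebergRandomFuture_lambertianEuler_of_hearts (h3 : KineticOneBlockInMeanLambda)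
    (h4 : CollisionalOneBlockInMeanLambda)
    (hD : Summit.AtomisticToContinuum.HydrodynamicLimit.Theses.ImplosionDichotomy.DiluteSelfConsistency) :
    Summit.AtomisticToContinuum.HydrodynamicLimit.Theses.LindebergRandomFuture.LambertianEuler :=
  lambertianEuler_of_hearts h3 h4 hD

end Summit.AtomisticToContinuum.HydrodynamicLimit.Theorems.LambertianContactSwapLambertianEulerOfHearts
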